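import Mathlib

/-!
# SoloBlind — E13 local constancy (solo-blind HodgeConjecture, s139)

Certificate behind THEOREM E13-NINETY (work/s139/e13.md §13).  On the critical stratum `e = 1/3`
of the wild-node tower at a Hermitian vertex of `X₁₀ = {Σ xᵢ⁶ + 10 ∏ xᵢ = 0}` the satellite
scheme is `V_{τ,δ} = {F_a = F_b = 0} ⊂ 𝔸²` (coordinates `ũ = (a, b, -a-b)` on the K-plane,
`d_K = d₁(1,0,-1) + d₂(0,1,-1)`, Artin–Schreier matrix `Ē₁ = [[2d₁+3d₂, 3d₁+d₂],[d₁+3d₂, 3d₁+2d₂]]`,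
unit parameter `τ`), and the first `ũ`-dependent coefficient of the node functional is
`f₉ = ℓ̄ + τ·Q_δ + τ²·e₃` with `ℓ̄ = Σ d_{K,i} ũᵢ⁵`, `Q_δ = 3 Σ d_{K,i} ũᵢ²`, `e₃ = ũ₀ũ₁ũ₂`.

The identities below (all `ring` identities over an arbitrary commutative ring, then specialised to
characteristic `5`) show:

* `V` is the critical scheme of the explicit sextic potential
  `Ψ = 3a⁶ + 4a⁵b + 4ab⁵ + 3b⁶ + Q_δ − 2τ e₃`: its hand-expanded partial derivatives `PsiDa`, `PsiDb`
  equal `2F_a + F_b` and `F_a + 2F_b` in characteristic `5` (`psiDa_eq`, `psiDb_eq`);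
* the EULER IDENTITY `(2a+b)·F_a + (a+2b)·F_b − Ψ = Q_δ + τ e₃` in characteristic `5`
  (`euler_identity`), hence on `V` the cubic part of `f₉` is `Q_δ + τ e₃ = −Ψ`
  (`cubicPart_eq_neg_psi`), a function whose differential vanishes on `V = Crit Ψ`.

Consequently `f₉|_V = ℓ̄ − τΨ` has zero Kähler differential on `V` for every `(τ, δ)`; together with
`ℓ̄` being a combination of fifth powers this makes `f₉` locally constant on `V` whenever the fat
points of `V` have nilpotents of order `≤ 5` (all rational cases), which is the hypothesis of
E13-NINETY (≤ 15 wild nodes per cluster, ≤ 90 ≤ 92 per vertex, no étaleness assumption).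
Mathlib only; no `sorry`.
-/

namespace Summit.HodgeConjecture.HodgeConjecture.Theorems.SoloBlindE13LocalConstancy

variable {R : Type*} [CommRing R]

/-- First satellite equation `F_a = 4a⁵ + (Ē₁ũ)_a + τ q_a`, `q_a = a² + 3ab + 3b²`. -/
def Fa (a b d₁ d₂ τ : R) : R :=
  4*a^5 + (2*d₁ + 3*d₂)*a + (3*d₁ + d₂)*b + τ*(a^2 + 3*a*b + 3*b^2)

/-- Second satellite equation `F_b = 4b⁵ + (Ē₁ũ)_b + τ q_b`, `q_b = 3a² + 3ab + b²`. -/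
def Fb (a b d₁ d₂ τ : R) : R :=
  4*b^5 + (d₁ + 3*d₂)*a + (3*d₁ + 2*d₂)*b + τ*(3*a^2 + 3*a*b + b^2)

/-- The quadratic part `Q_δ = 3 Σ d_{K,i} ũᵢ²` with `ũ = (a,b,-a-b)`, `d_K = (d₁,d₂,-d₁-d₂)`. -/
def Qδ (a b d₁ d₂ : R) : R :=
  3*(d₁*a^2 + d₂*b^2 + (-d₁ - d₂)*(a + b)^2)

/-- The cubic `e₃ = ũ₀ũ₁ũ₂ = ab(-a-b)`. -/
def e3 (a b : R) : R := a*b*(-a - b)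

/-- The sextic potential `Ψ = 3a⁶ + 4a⁵b + 4ab⁵ + 3b⁶ + Q_δ − 2τ e₃`. -/
def Psi (a b d₁ d₂ τ : R) : R :=
  3*a^6 + 4*a^5*b + 4*a*b^5 + 3*b^6 + Qδ a b d₁ d₂ - 2*τ*(e3 a b)

/-- Hand-expanded partial derivative `∂Ψ/∂a`. -/
def PsiDa (a b d₁ d₂ τ : R) : R :=
  18*a^5 + 20*a^4*b + 4*b^5 + 3*(2*d₁*a - 2*(d₁ + d₂)*(a + b)) - 2*τ*(-2*a*b - b^2)

/-- Hand-expanded partial derivative `∂Ψ/∂b`. -/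
def PsiDb (a b d₁ d₂ τ : R) : R :=
  4*a^5 + 20*a*b^4 + 18*b^5 + 3*(2*d₂*b - 2*(d₁ + d₂)*(a + b)) - 2*τ*(-a^2 - 2*a*b)

/-- Integral form of the Euler identity: `(2a+b)F_a + (a+2b)F_b − Ψ − (Q_δ + τ e₃)` is `5` times
an explicit polynomial. -/
theorem euler_identity_int (a b d₁ d₂ τ : R) :
    (2*a + b) * Fa a b d₁ d₂ τ + (a + 2*b) * Fb a b d₁ d₂ τ - Psi a b d₁ d₂ τ
      - (Qδ a b d₁ d₂ + τ * e3 a b)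
      = 5 * (a^6 + b^6 + (d₁ + 3*d₂)*a^2 + 5*(d₁ + d₂)*a*b + (3*d₁ + d₂)*b^2 + τ*(a + b)^3) := by
  unfold Fa Fb Psi Qδ e3; ring

/-- Integral form: `∂Ψ/∂a − (2F_a + F_b)` is `5` times an explicit polynomial. -/
theorem psiDa_int (a b d₁ d₂ τ : R) :
    PsiDa a b d₁ d₂ τ - (2 * Fa a b d₁ d₂ τ + Fb a b d₁ d₂ τ)
      = 5 * (2*a^5 + 4*a^4*b - (d₁ + 3*d₂)*a - (3*d₁ + 2*d₂)*b - τ*(a^2 + a*b + b^2)) := by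
  unfold PsiDa Fa Fb; ring

/-- Integral form: `∂Ψ/∂b − (F_a + 2F_b)` is `5` times an explicit polynomial. -/
theorem psiDb_int (a b d₁ d₂ τ : R) :
    PsiDb a b d₁ d₂ τ - (Fa a b d₁ d₂ τ + 2 * Fb a b d₁ d₂ τ)
      = 5 * (4*a*b^4 + 2*b^5 - (2*d₁ + 3*d₂)*a - (3*d₁ + d₂)*b - τ*(a^2 + a*b + b^2)) := by
  unfold PsiDb Fa Fb; ring

section CharFive

variable [CharP R 5]

/-- In characteristic `5`: the EULER IDENTITY `(2a+b)F_a + (a+2b)F_b − Ψ = Q_δ + τ e₃`. -/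
theorem euler_identity (a b d₁ d₂ τ : R) :
    (2*a + b) * Fa a b d₁ d₂ τ + (a + 2*b) * Fb a b d₁ d₂ τ - Psi a b d₁ d₂ τ
      = Qδ a b d₁ d₂ + τ * e3 a b := by
  have h5 : (5 : R) = 0 := CharP.cast_eq_zero R 5
  have h := euler_identity_int a b d₁ d₂ τ
  rw [h5, zero_mul] at h
  exact sub_eq_zero.mp h

/-- In characteristic `5`: `∂Ψ/∂a = 2F_a + F_b`, so `V = {F = 0}` is the critical scheme of `Ψ`. -/
theorem psiDa_eq (a b d₁ d₂ τ : R) :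
    PsiDa a b d₁ d₂ τ = 2 * Fa a b d₁ d₂ τ + Fb a b d₁ d₂ τ := by
  have h5 : (5 : R) = 0 := CharP.cast_eq_zero R 5
  have h := psiDa_int a b d₁ d₂ τ
  rw [h5, zero_mul] at h
  exact sub_eq_zero.mp h

/-- In characteristic `5`: `∂Ψ/∂b = F_a + 2F_b`. -/
theorem psiDb_eq (a b d₁ d₂ τ : R) :
    PsiDb a b d₁ d₂ τ = Fa a b d₁ d₂ τ + 2 * Fb a b d₁ d₂ τ := by
  have h5 : (5 : R) = 0 := CharP.cast_eq_zero R 5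
  have h := psiDb_int a b d₁ d₂ τ
  rw [h5, zero_mul] at h
  exact sub_eq_zero.mp h

/-- On the satellite scheme (`F_a = F_b = 0`) the cubic part of `f₉` equals `−Ψ`:
`Q_δ + τ e₃ = −Ψ`.  Hence `f₉|_V = ℓ̄ − τΨ|_V`. -/
theorem cubicPart_eq_neg_psi (a b d₁ d₂ τ : R)
    (hFa : Fa a b d₁ d₂ τ = 0) (hFb : Fb a b d₁ d₂ τ = 0) :
    Qδ a b d₁ d₂ + τ * e3 a b = - Psi a b d₁ d₂ τ := by
  have h := euler_identity a b d₁ d₂ τ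
  rw [hFa, hFb, mul_zero, mul_zero, zero_add, zero_sub] at h
  exact h.symm

/-- On the satellite scheme both partial derivatives of `Ψ` vanish: `V ⊆ Crit Ψ`
(and conversely, the matrix `[[2,1],[1,2]]` being invertible in characteristic `5`). -/
theorem psi_partials_zero (a b d₁ d₂ τ : R)
    (hFa : Fa a b d₁ d₂ τ = 0) (hFb : Fb a b d₁ d₂ τ = 0) :
    PsiDa a b d₁ d₂ τ = 0 ∧ PsiDb a b d₁ d₂ τ = 0 := by
  refine ⟨?_, ?_⟩
  · rw [psiDa_eq, hFa, hFb]; ring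
  · rw [psiDb_eq, hFa, hFb]; ring

/-- Converse direction: `F_a = 2·∂Ψ/∂a − ∂Ψ/∂b` and `F_b = 2·∂Ψ/∂b − ∂Ψ/∂a` up to the unit `3`
(`[[2,1],[1,2]]⁻¹ = 3⁻¹·[[2,-1],[-1,2]]`): precisely `3 F_a = 2 PsiDa − PsiDb` and
`3 F_b = 2 PsiDb − PsiDa`. -/
theorem F_of_psi_partials (a b d₁ d₂ τ : R) :
    3 * Fa a b d₁ d₂ τ = 2 * PsiDa a b d₁ d₂ τ - PsiDb a b d₁ d₂ τ ∧
    3 * Fb a b d₁ d₂ τ = 2 * PsiDb a b d₁ d₂ τ - PsiDa a b d₁ d₂ τ := by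
  refine ⟨?_, ?_⟩
  · rw [psiDa_eq, psiDb_eq]; ring
  · rw [psiDa_eq, psiDb_eq]; ring

end CharFive

end Summit.HodgeConjecture.HodgeConjecture.Theorems.SoloBlindE13LocalConstancy
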